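/-
COR-CM (cell pub-hodgecm2, stage 2 of the Hodge ladder) — count-neutral KERNEL CENSUS TRANSPORT, INTRINSIC FORM, degree 12, type `Dic₃`
(seat prover-pub-hodgecm2-b23-g33-0, binder prover b23, gen 33; claim INT2-INTRINSIC addendum DEG12-GENERATORS; sequel of
`Census/DuodecicFaceTransportDicyclic.lean` and `CorCM/FaceCensusGroupDictionary.lean`). Theorems only; no definition, no named fact, nothing
asserted; the census dictionary (`enum`, `group_spec` of `Census/DuodecicFaceGeneratorsDicyclic.lean`) is consumed BY NAME; `Interfaces.lean` (C1), every E
term, B01 and `Transposition/*` are untouched. HONEST FRAMING (COORDINATOR RULING — HODGE FRAMING CORRECTION, 2026-08-21T11:55:35Z): `HC_CM` is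
NOT proved, here or anywhere in the tree. Every closing theorem below is CONDITIONAL on face-period witnesses (for ONE field, on the listed faces);
no period is proved here.
T5 (coordinator ruling 15:33:56Z (3), lead staging l.4095): the DICTIONARY binders of `…_duodecicDicyclic_aut` (`ε`, `hε`, `c`, `hc`, `ε c = Γ.conj`) are
DISCHARGED here from ONE isomorphism `e : Gal(K/ℚ) ≃* QuaternionGroup 3`; the face-reading
binders are inhabited in the kernel (`exists_face_<code>_of_mulEquiv`); the only remaining hypotheses are the period witnesses on the listed faces =
instances of the crux (`FacePeriodExists` / B01-S), against which the tree has no `¬` theorem on the universe of record — no contradiction derivable;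
checker: self (prover-pub-hodgecm2-b23-g33-0), 2026-08-21.
-/
import Summits.HodgeConjecture.CorCM.FaceCensusGroupDictionary
import Summits.HodgeConjecture.CorCM.Census.DuodecicFaceTransportDicyclic
import Mathlib.GroupTheory.SpecificGroups.Quaternion
import HarnessLib

/-!
# Galois CM fields of degree 12 with group `Dic₃`: field closure from an isomorphism with the Mathlib group (intrinsic form)

Fields of this type: dodecic Galois CM fields with dicyclic group `Dic₃ = C₃ ⋊ C₄` (complex conjugation = the unique involution `a 3`).  The automorphism-form field-closure theorem `…_duodecicDicyclic_aut` (`Census/DuodecicFaceTransportDicyclic.lean`) takes an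
enumeration `ε : Aut(K) ≃ Fin 12` multiplicative for the census table, the conjugation automorphism `c` at `σ₀` and `ε c = Γ.conj` as
hypotheses.  Here all of it is derived from ONE isomorphism `e : Gal(K/ℚ) ≃* QuaternionGroup 3` (`FaceCensus.exists_enum_of_groupEnum` over the
certified dictionary `group_spec`); complex conjugation reads `Γ.conj` because complex conjugation is an involution `≠ 1`, and `a 3` is the ONLY involution of `Dic₃`.  The 5 generating
faces of the census (minimal number of face ORBITS for this type by the exact model, kit job j137010) then read as explicit group data
(`…_mulEquiv`), and they exist for every such `K`, `e`, `σ₀` (`exists_face_<code>_of_mulEquiv`).  `HC_CM` is NOT proved and nothing here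
produces a period.

References: [cite: Pohlmann1968, Thm. 1]; [cite: Milne1999LefschetzClasses, Thm. 3.2 and Cor. 4.5];
[cite: Shimura1998, §6.2 Theorem 3 and §6.1 Corollary of Theorem 2 (pp. 41–43)]; [cite: MumfordAV1970, §19 Thm. 1 and p. 169].
-/

noncomputable section

open CategoryTheory NumberField NumberField.ComplexEmbedding
open Literature.AlgebraicGeometry Literature.AlgebraicGeometry.Motives Literature.AlgebraicGeometry.HodgeTheory
open Literature.AlgebraicGeometry.ComplexMultiplication Literature.AlgebraicGeometry.Milne1999
open Literature.NumberTheory.Automorphic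
open Literature.NumberTheory.Automorphic.PicardCM
open Summit.HodgeConjecture.CorCM.Domination

namespace Summit.HodgeConjecture.CorCM.DuodecicFaceTransport.Dicyclic

open Summit.HodgeConjecture.CorCM.Census.FaceSquaresModel (mem)
open Summit.HodgeConjecture.CorCM.Census.DuodecicFaceGeneratorsDicyclic (Γ enum group_spec)

/-- `QuaternionGroup 3` (`Dic₃`): the only involution is `a 3`. [folklore] -/
theorem involution_eq : ∀ x : QuaternionGroup 3, x ≠ 1 → x * x = 1 → x = QuaternionGroup.a 3 := by decide

/-- **The dictionary from an isomorphism with `QuaternionGroup 3`, type `Dic₃`.**  `K` a Galois CM field, `e : Gal(K/ℚ) ≃* QuaternionGroup 3`, `σ₀` a base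
embedding.  Then there is an enumeration `ε : Aut(K) ≃ Fin 12`, multiplicative for the Cayley table of `Census/DuodecicFaceGeneratorsDicyclic.lean`, reading `e`
through `enum`, under which THE automorphism inducing complex conjugation at `σ₀` reads `Γ.conj` — proved, not assumed: complex conjugation is an involution `≠ 1`, and `a 3` is the ONLY involution of `Dic₃`. [folklore] -/
theorem exists_autEnum_of_mulEquiv (K : CMField) [IsGalois ℚ K] (e : ((K : Type) ≃ₐ[ℚ] (K : Type)) ≃* QuaternionGroup 3) (σ₀ : (K : Type) →+* ℂ) :
    ∃ ε : ((K : Type) ≃ₐ[ℚ] (K : Type)) ≃ Fin 12,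
      (∀ x y : ((K : Type) ≃ₐ[ℚ] (K : Type)), ε (x * y) = Γ.mul (ε x) (ε y)) ∧ (∀ h : ((K : Type) ≃ₐ[ℚ] (K : Type)), enum (ε h) = e h) ∧
      (∀ (h : ((K : Type) ≃ₐ[ℚ] (K : Type))) (i : Fin 12), e h = enum i → ε h = i) ∧
      ∀ c : ((K : Type) ≃ₐ[ℚ] (K : Type)), σ₀.comp (c : (K : Type) →+* (K : Type)) = conjugate σ₀ → ε c = Γ.conj := by
  obtain ⟨ε, hε, hread⟩ := FaceCensus.exists_enum_of_groupEnum Γ (· * ·) enum group_spec.2.1 group_spec.2.2.1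
    (by rw [QuaternionGroup.card]) e e.bijective (map_mul e)
  refine ⟨ε, hε, hread, fun h i hh => group_spec.2.2.1 ((hread h).trans hh), fun c hc => group_spec.2.2.1 ?_⟩
  rw [hread, group_spec.2.2.2]
  exact involution_eq _ ((MulEquiv.map_ne_one_iff e).mpr (FaceCensus.conjAut_ne_one σ₀ hc))
      (by rw [← map_mul, FaceCensus.conjAut_mul_self σ₀ hc, map_one])

/-- The base type of code `455`, read in `QuaternionGroup 3`. [folklore] -/
theorem mem_455_iff_enum : ∀ i : Fin 12, mem i 455 = true ↔ enum i ∈ ({QuaternionGroup.a 0, QuaternionGroup.a 1, QuaternionGroup.a 2, QuaternionGroup.xa 0, QuaternionGroup.xa 1, QuaternionGroup.xa 2} : Finset (QuaternionGroup 3)) := by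
  decide

/-- The base type of code `462`, read in `QuaternionGroup 3`. [folklore] -/
theorem mem_462_iff_enum : ∀ i : Fin 12, mem i 462 = true ↔ enum i ∈ ({QuaternionGroup.a 1, QuaternionGroup.a 2, QuaternionGroup.a 3, QuaternionGroup.xa 0, QuaternionGroup.xa 1, QuaternionGroup.xa 2} : Finset (QuaternionGroup 3)) := by
  decide

/-- The base type of code `469`, read in `QuaternionGroup 3`. [folklore] -/
theorem mem_469_iff_enum : ∀ i : Fin 12, mem i 469 = true ↔ enum i ∈ ({QuaternionGroup.a 0, QuaternionGroup.a 2, QuaternionGroup.a 4, QuaternionGroup.xa 0, QuaternionGroup.xa 1, QuaternionGroup.xa 2} : Finset (QuaternionGroup 3)) := by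
  decide

/-- **Non-vacuity for the base type of code `455`, type `Dic₃`.**  For every two group elements `x, y` at different places (`y ≠ x`,
`y ≠ c·x`) there is a rank-four face with base type `Φ` reading `σ₀ ∘ h ∈ Φ ↔ e h ∈ {a 0, a 1, a 2, xa 0, xa 1, xa 2}` and place
representatives `σ₀ ∘ e⁻¹(x)`, `σ₀ ∘ e⁻¹(y)`. [folklore] -/
theorem exists_face_455_of_mulEquiv (K : CMField) [IsGalois ℚ K] (e : ((K : Type) ≃ₐ[ℚ] (K : Type)) ≃* QuaternionGroup 3) (σ₀ : (K : Type) →+* ℂ)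
    (x y : QuaternionGroup 3) (hxy : x ≠ y ∧ QuaternionGroup.a 3 * x ≠ y) :
    ∃ R : Face K, (∀ h : ((K : Type) ≃ₐ[ℚ] (K : Type)), σ₀.comp (h : (K : Type) →+* (K : Type)) ∈ R.Φ.1 ↔ e h ∈ ({QuaternionGroup.a 0, QuaternionGroup.a 1, QuaternionGroup.a 2, QuaternionGroup.xa 0, QuaternionGroup.xa 1, QuaternionGroup.xa 2} : Finset (QuaternionGroup 3))) ∧
      R.p = σ₀.comp ((e.symm x : ((K : Type) ≃ₐ[ℚ] (K : Type))) : (K : Type) →+* (K : Type)) ∧ R.p' = σ₀.comp ((e.symm y : ((K : Type) ≃ₐ[ℚ] (K : Type))) : (K : Type) →+* (K : Type)) := by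
  obtain ⟨ε, hε, hread, hidx, hconj⟩ := exists_autEnum_of_mulEquiv K e σ₀
  obtain ⟨c, hc⟩ := FaceCensus.exists_conjAut σ₀
  obtain ⟨e', hmul, he⟩ := FaceCensus.exists_enum_of_autEnum Γ σ₀ ε hε
  have hconj' : e' conjT = Γ.conj := by rw [FaceCensus.conjT_eq_translate σ₀, ← hc, he, hconj c hc]
  obtain ⟨R₀, hT₀, -, -⟩ := FaceCensus.exists_face_reads Γ e' hmul hconj' σ₀ (r := (455, 9, 18)) (by decide +kernel)
  have hne : InfinitePlace.mk (σ₀.comp ((e.symm x : ((K : Type) ≃ₐ[ℚ] (K : Type))) : (K : Type) →+* (K : Type))) ≠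
      InfinitePlace.mk (σ₀.comp ((e.symm y : ((K : Type) ≃ₐ[ℚ] (K : Type))) : (K : Type) →+* (K : Type))) := by
    rw [Ne, FaceCensus.mk_comp_eq_mk_comp_iff σ₀ hc]
    rintro (h | h)
    · exact hxy.1 (by simpa using congrArg e h)
    · refine hxy.2 ?_
      have h2 := congrArg e h
      simp only [map_mul, MulEquiv.apply_symm_apply] at h2
      rw [← h2, ← group_spec.2.2.2, ← hread, hconj c hc]
  refine ⟨⟨R₀.Φ, _, _, hne⟩, fun h => ?_, rfl, rfl⟩
  have hk := hT₀.2 (e' (translate σ₀ (σ₀.comp (h : (K : Type) →+* (K : Type)))))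
  rw [e'.symm_apply_apply, mem_pullType, translate_apply_self, he] at hk
  rw [← hread h]
  exact hk.symm.trans (mem_455_iff_enum (ε h))

/-- **Non-vacuity for the base type of code `462`, type `Dic₃`.**  For every two group elements `x, y` at different places (`y ≠ x`,
`y ≠ c·x`) there is a rank-four face with base type `Φ` reading `σ₀ ∘ h ∈ Φ ↔ e h ∈ {a 1, a 2, a 3, xa 0, xa 1, xa 2}` and place
representatives `σ₀ ∘ e⁻¹(x)`, `σ₀ ∘ e⁻¹(y)`. [folklore] -/
theorem exists_face_462_of_mulEquiv (K : CMField) [IsGalois ℚ K] (e : ((K : Type) ≃ₐ[ℚ] (K : Type)) ≃* QuaternionGroup 3) (σ₀ : (K : Type) →+* ℂ)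
    (x y : QuaternionGroup 3) (hxy : x ≠ y ∧ QuaternionGroup.a 3 * x ≠ y) :
    ∃ R : Face K, (∀ h : ((K : Type) ≃ₐ[ℚ] (K : Type)), σ₀.comp (h : (K : Type) →+* (K : Type)) ∈ R.Φ.1 ↔ e h ∈ ({QuaternionGroup.a 1, QuaternionGroup.a 2, QuaternionGroup.a 3, QuaternionGroup.xa 0, QuaternionGroup.xa 1, QuaternionGroup.xa 2} : Finset (QuaternionGroup 3))) ∧
      R.p = σ₀.comp ((e.symm x : ((K : Type) ≃ₐ[ℚ] (K : Type))) : (K : Type) →+* (K : Type)) ∧ R.p' = σ₀.comp ((e.symm y : ((K : Type) ≃ₐ[ℚ] (K : Type))) : (K : Type) →+* (K : Type)) := by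
  obtain ⟨ε, hε, hread, hidx, hconj⟩ := exists_autEnum_of_mulEquiv K e σ₀
  obtain ⟨c, hc⟩ := FaceCensus.exists_conjAut σ₀
  obtain ⟨e', hmul, he⟩ := FaceCensus.exists_enum_of_autEnum Γ σ₀ ε hε
  have hconj' : e' conjT = Γ.conj := by rw [FaceCensus.conjT_eq_translate σ₀, ← hc, he, hconj c hc]
  obtain ⟨R₀, hT₀, -, -⟩ := FaceCensus.exists_face_reads Γ e' hmul hconj' σ₀ (r := (462, 18, 1152)) (by decide +kernel)
  have hne : InfinitePlace.mk (σ₀.comp ((e.symm x : ((K : Type) ≃ₐ[ℚ] (K : Type))) : (K : Type) →+* (K : Type))) ≠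
      InfinitePlace.mk (σ₀.comp ((e.symm y : ((K : Type) ≃ₐ[ℚ] (K : Type))) : (K : Type) →+* (K : Type))) := by
    rw [Ne, FaceCensus.mk_comp_eq_mk_comp_iff σ₀ hc]
    rintro (h | h)
    · exact hxy.1 (by simpa using congrArg e h)
    · refine hxy.2 ?_
      have h2 := congrArg e h
      simp only [map_mul, MulEquiv.apply_symm_apply] at h2
      rw [← h2, ← group_spec.2.2.2, ← hread, hconj c hc]
  refine ⟨⟨R₀.Φ, _, _, hne⟩, fun h => ?_, rfl, rfl⟩
  have hk := hT₀.2 (e' (translate σ₀ (σ₀.comp (h : (K : Type) →+* (K : Type)))))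
  rw [e'.symm_apply_apply, mem_pullType, translate_apply_self, he] at hk
  rw [← hread h]
  exact hk.symm.trans (mem_462_iff_enum (ε h))

/-- **Non-vacuity for the base type of code `469`, type `Dic₃`.**  For every two group elements `x, y` at different places (`y ≠ x`,
`y ≠ c·x`) there is a rank-four face with base type `Φ` reading `σ₀ ∘ h ∈ Φ ↔ e h ∈ {a 0, a 2, a 4, xa 0, xa 1, xa 2}` and place
representatives `σ₀ ∘ e⁻¹(x)`, `σ₀ ∘ e⁻¹(y)`. [folklore] -/
theorem exists_face_469_of_mulEquiv (K : CMField) [IsGalois ℚ K] (e : ((K : Type) ≃ₐ[ℚ] (K : Type)) ≃* QuaternionGroup 3) (σ₀ : (K : Type) →+* ℂ)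
    (x y : QuaternionGroup 3) (hxy : x ≠ y ∧ QuaternionGroup.a 3 * x ≠ y) :
    ∃ R : Face K, (∀ h : ((K : Type) ≃ₐ[ℚ] (K : Type)), σ₀.comp (h : (K : Type) →+* (K : Type)) ∈ R.Φ.1 ↔ e h ∈ ({QuaternionGroup.a 0, QuaternionGroup.a 2, QuaternionGroup.a 4, QuaternionGroup.xa 0, QuaternionGroup.xa 1, QuaternionGroup.xa 2} : Finset (QuaternionGroup 3))) ∧
      R.p = σ₀.comp ((e.symm x : ((K : Type) ≃ₐ[ℚ] (K : Type))) : (K : Type) →+* (K : Type)) ∧ R.p' = σ₀.comp ((e.symm y : ((K : Type) ≃ₐ[ℚ] (K : Type))) : (K : Type) →+* (K : Type)) := by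
  obtain ⟨ε, hε, hread, hidx, hconj⟩ := exists_autEnum_of_mulEquiv K e σ₀
  obtain ⟨c, hc⟩ := FaceCensus.exists_conjAut σ₀
  obtain ⟨e', hmul, he⟩ := FaceCensus.exists_enum_of_autEnum Γ σ₀ ε hε
  have hconj' : e' conjT = Γ.conj := by rw [FaceCensus.conjT_eq_translate σ₀, ← hc, he, hconj c hc]
  obtain ⟨R₀, hT₀, -, -⟩ := FaceCensus.exists_face_reads Γ e' hmul hconj' σ₀ (r := (469, 576, 1152)) (by decide +kernel)
  have hne : InfinitePlace.mk (σ₀.comp ((e.symm x : ((K : Type) ≃ₐ[ℚ] (K : Type))) : (K : Type) →+* (K : Type))) ≠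
      InfinitePlace.mk (σ₀.comp ((e.symm y : ((K : Type) ≃ₐ[ℚ] (K : Type))) : (K : Type) →+* (K : Type))) := by
    rw [Ne, FaceCensus.mk_comp_eq_mk_comp_iff σ₀ hc]
    rintro (h | h)
    · exact hxy.1 (by simpa using congrArg e h)
    · refine hxy.2 ?_
      have h2 := congrArg e h
      simp only [map_mul, MulEquiv.apply_symm_apply] at h2
      rw [← h2, ← group_spec.2.2.2, ← hread, hconj c hc]
  refine ⟨⟨R₀.Φ, _, _, hne⟩, fun h => ?_, rfl, rfl⟩
  have hk := hT₀.2 (e' (translate σ₀ (σ₀.comp (h : (K : Type) →+* (K : Type)))))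
  rw [e'.symm_apply_apply, mem_pullType, translate_apply_self, he] at hk
  rw [← hread h]
  exact hk.symm.trans (mem_469_iff_enum (ε h))

/-- **FIELD CLOSURE FROM `Gal(K/ℚ) ≃* QuaternionGroup 3`, type `Dic₃` — CLOSED, headline.**  `K` a Galois CM field with an isomorphism
`e : Gal(K/ℚ) ≃* QuaternionGroup 3` (so `[K:ℚ] = 12`), complex conjugation read off `e` automatically; `σ₀` a base embedding; the 5 faces `R₁`: type `455` ↔ `{a 0, a 1, a 2, xa 0, xa 1, xa 2}`, places `e⁻¹(a 0)`, `e⁻¹(a 1)`; `R₂`: type `455` ↔ `{a 0, a 1, a 2, xa 0, xa 1, xa 2}`, places `e⁻¹(a 0)`, `e⁻¹(xa 2)`; `R₃`: type `462` ↔ `{a 1, a 2, a 3, xa 0, xa 1, xa 2}`, places `e⁻¹(a 1)`, `e⁻¹(xa 1)`; `R₄`: type `469` ↔ `{a 0, a 2, a 4, xa 0, xa 1, xa 2}`, places `e⁻¹(xa 0)`, `e⁻¹(xa 1)`; `R₅`: type `469` ↔ `{a 0, a 2, a 4, xa 0, xa 1, xa 2}`, places `e⁻¹(xa 0)`, `e⁻¹(xa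 2)` (they exist:
`exists_face_<code>_of_mulEquiv`).  ONE period witness for each on the universe of record implies the Hodge conjecture, in every codimension,
for every complex abelian variety dominated by a finite product of abelian varieties realising CM types of CM fields embeddable in `K`.  No
enumeration, table or conjugation-index hypothesis is left (`exists_autEnum_of_mulEquiv`).  (FRAMING: conditional on these 5 face periods;
`HC_CM` is NOT proved.) [cite: Shimura1998, §6.2 Theorem 3 and §6.1 Corollary of Theorem 2 (pp. 41–43)] [cite: Pohlmann1968, Thm. 1]
[cite: Milne1999LefschetzClasses, Thm. 3.2 and Cor. 4.5] [cite: MumfordAV1970, §19 Thm. 1 and p. 169] -/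
theorem hodgeConjectureFor_of_avDominatedBy_isProductOf_of_facePeriod_duodecicDicyclic_mulEquiv (K : CMField) [IsGalois ℚ K]
    (e : ((K : Type) ≃ₐ[ℚ] (K : Type)) ≃* QuaternionGroup 3) (σ₀ : (K : Type) →+* ℂ) (R₁ R₂ R₃ R₄ R₅ : Face K)
    (hΦ₁ : ∀ h : ((K : Type) ≃ₐ[ℚ] (K : Type)), σ₀.comp (h : (K : Type) →+* (K : Type)) ∈ R₁.Φ.1 ↔ e h ∈ ({QuaternionGroup.a 0, QuaternionGroup.a 1, QuaternionGroup.a 2, QuaternionGroup.xa 0, QuaternionGroup.xa 1, QuaternionGroup.xa 2} : Finset (QuaternionGroup 3)))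
    (hp₁ : R₁.p = σ₀.comp ((e.symm (QuaternionGroup.a 0) : ((K : Type) ≃ₐ[ℚ] (K : Type))) : (K : Type) →+* (K : Type)))
    (hq₁ : R₁.p' = σ₀.comp ((e.symm (QuaternionGroup.a 1) : ((K : Type) ≃ₐ[ℚ] (K : Type))) : (K : Type) →+* (K : Type)))
    (hΦ₂ : ∀ h : ((K : Type) ≃ₐ[ℚ] (K : Type)), σ₀.comp (h : (K : Type) →+* (K : Type)) ∈ R₂.Φ.1 ↔ e h ∈ ({QuaternionGroup.a 0, QuaternionGroup.a 1, QuaternionGroup.a 2, QuaternionGroup.xa 0, QuaternionGroup.xa 1, QuaternionGroup.xa 2} : Finset (QuaternionGroup 3)))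
    (hp₂ : R₂.p = σ₀.comp ((e.symm (QuaternionGroup.a 0) : ((K : Type) ≃ₐ[ℚ] (K : Type))) : (K : Type) →+* (K : Type)))
    (hq₂ : R₂.p' = σ₀.comp ((e.symm (QuaternionGroup.xa 2) : ((K : Type) ≃ₐ[ℚ] (K : Type))) : (K : Type) →+* (K : Type)))
    (hΦ₃ : ∀ h : ((K : Type) ≃ₐ[ℚ] (K : Type)), σ₀.comp (h : (K : Type) →+* (K : Type)) ∈ R₃.Φ.1 ↔ e h ∈ ({QuaternionGroup.a 1, QuaternionGroup.a 2, QuaternionGroup.a 3, QuaternionGroup.xa 0, QuaternionGroup.xa 1, QuaternionGroup.xa 2} : Finset (QuaternionGroup 3)))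
    (hp₃ : R₃.p = σ₀.comp ((e.symm (QuaternionGroup.a 1) : ((K : Type) ≃ₐ[ℚ] (K : Type))) : (K : Type) →+* (K : Type)))
    (hq₃ : R₃.p' = σ₀.comp ((e.symm (QuaternionGroup.xa 1) : ((K : Type) ≃ₐ[ℚ] (K : Type))) : (K : Type) →+* (K : Type)))
    (hΦ₄ : ∀ h : ((K : Type) ≃ₐ[ℚ] (K : Type)), σ₀.comp (h : (K : Type) →+* (K : Type)) ∈ R₄.Φ.1 ↔ e h ∈ ({QuaternionGroup.a 0, QuaternionGroup.a 2, QuaternionGroup.a 4, QuaternionGroup.xa 0, QuaternionGroup.xa 1, QuaternionGroup.xa 2} : Finset (QuaternionGroup 3)))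
    (hp₄ : R₄.p = σ₀.comp ((e.symm (QuaternionGroup.xa 0) : ((K : Type) ≃ₐ[ℚ] (K : Type))) : (K : Type) →+* (K : Type)))
    (hq₄ : R₄.p' = σ₀.comp ((e.symm (QuaternionGroup.xa 1) : ((K : Type) ≃ₐ[ℚ] (K : Type))) : (K : Type) →+* (K : Type)))
    (hΦ₅ : ∀ h : ((K : Type) ≃ₐ[ℚ] (K : Type)), σ₀.comp (h : (K : Type) →+* (K : Type)) ∈ R₅.Φ.1 ↔ e h ∈ ({QuaternionGroup.a 0, QuaternionGroup.a 2, QuaternionGroup.a 4, QuaternionGroup.xa 0, QuaternionGroup.xa 1, QuaternionGroup.xa 2} : Finset (QuaternionGroup 3)))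
    (hp₅ : R₅.p = σ₀.comp ((e.symm (QuaternionGroup.xa 0) : ((K : Type) ≃ₐ[ℚ] (K : Type))) : (K : Type) →+* (K : Type)))
    (hq₅ : R₅.p' = σ₀.comp ((e.symm (QuaternionGroup.xa 2) : ((K : Type) ≃ₐ[ℚ] (K : Type))) : (K : Type) →+* (K : Type)))
    (h₁ : ∃ ι₁ : K →+* ℂ, R₁.Admissible ι₁ ∧ ∃ (V : HermSpace3 K ι₁) (σ : K →+* ℂ),
      (Model.picardCMUniverse exists_isReal_hodgeModel_holds hodgePQ_independent_of_hodgeModel_holds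
        BallQuotient.ballQuotientUniformised_holds cmAbelianVarietyRealised_holds).PeriodNV ι₁ V K R₁.psi σ)
    (h₂ : ∃ ι₁ : K →+* ℂ, R₂.Admissible ι₁ ∧ ∃ (V : HermSpace3 K ι₁) (σ : K →+* ℂ),
      (Model.picardCMUniverse exists_isReal_hodgeModel_holds hodgePQ_independent_of_hodgeModel_holds
        BallQuotient.ballQuotientUniformised_holds cmAbelianVarietyRealised_holds).PeriodNV ι₁ V K R₂.psi σ)
    (h₃ : ∃ ι₁ : K →+* ℂ, R₃.Admissible ι₁ ∧ ∃ (V : HermSpace3 K ι₁) (σ : K →+* ℂ),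
      (Model.picardCMUniverse exists_isReal_hodgeModel_holds hodgePQ_independent_of_hodgeModel_holds
        BallQuotient.ballQuotientUniformised_holds cmAbelianVarietyRealised_holds).PeriodNV ι₁ V K R₃.psi σ)
    (h₄ : ∃ ι₁ : K →+* ℂ, R₄.Admissible ι₁ ∧ ∃ (V : HermSpace3 K ι₁) (σ : K →+* ℂ),
      (Model.picardCMUniverse exists_isReal_hodgeModel_holds hodgePQ_independent_of_hodgeModel_holds
        BallQuotient.ballQuotientUniformised_holds cmAbelianVarietyRealised_holds).PeriodNV ι₁ V K R₄.psi σ)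
    (h₅ : ∃ ι₁ : K →+* ℂ, R₅.Admissible ι₁ ∧ ∃ (V : HermSpace3 K ι₁) (σ : K →+* ℂ),
      (Model.picardCMUniverse exists_isReal_hodgeModel_holds hodgePQ_independent_of_hodgeModel_holds
        BallQuotient.ballQuotientUniformised_holds cmAbelianVarietyRealised_holds).PeriodNV ι₁ V K R₅.psi σ)
    {P A : AbelianVariety ℂ} (hP : AbelianVariety.IsProductOf (fun B : AbelianVariety ℂ =>
      ∃ (E : Type) (_ : Field E) (_ : NumberField E) (_ : IsCMField E) (_ : E →+* (K : Type)) (Φ : CMType E)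
        (ι : 𝓞 E →+* End B) (θ : E →+* Module.End ℂ (complexBetti B.X 1)),
        IsCMTypeRealisation Φ B ι θ) P)
    (hA : AVDominatedBy A P) : HodgeConjectureFor A.dim A.X := by
  obtain ⟨ε, hε, hread, hidx, hconj⟩ := exists_autEnum_of_mulEquiv K e σ₀
  obtain ⟨c, hc⟩ := FaceCensus.exists_conjAut σ₀
  refine hodgeConjectureFor_of_avDominatedBy_isProductOf_of_facePeriod_duodecicDicyclic_aut K σ₀ ε hε c hc (hconj c hc) R₁ R₂ R₃ R₄ R₅
    (e.symm (QuaternionGroup.a 0)) (e.symm (QuaternionGroup.a 1))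
    (e.symm (QuaternionGroup.a 0)) (e.symm (QuaternionGroup.xa 2))
    (e.symm (QuaternionGroup.a 1)) (e.symm (QuaternionGroup.xa 1))
    (e.symm (QuaternionGroup.xa 0)) (e.symm (QuaternionGroup.xa 1))
    (e.symm (QuaternionGroup.xa 0)) (e.symm (QuaternionGroup.xa 2))
    ?_ ?_ ?_ ?_ ?_ ?_ ?_ ?_ ?_ ?_ ?_ ?_ ?_ ?_ ?_ ?_ ?_ ?_ ?_ ?_ ?_ ?_ ?_ ?_ ?_ h₁ h₂ h₃ h₄ h₅ hP hA
  · intro h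
    rw [hΦ₁, ← hread h]
    exact (mem_455_iff_enum (ε h)).symm
  · exact hp₁
  · rw [hidx _ 0 (by rw [MulEquiv.apply_symm_apply]; decide)]; decide
  · exact hq₁
  · rw [hidx _ 1 (by rw [MulEquiv.apply_symm_apply]; decide)]; decide
  · intro h
    rw [hΦ₂, ← hread h]
    exact (mem_455_iff_enum (ε h)).symm
  · exact hp₂
  · rw [hidx _ 0 (by rw [MulEquiv.apply_symm_apply]; decide)]; decide
  · exact hq₂
  · rw [hidx _ 8 (by rw [MulEquiv.apply_symm_apply]; decide)]; decide
  · intro h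
    rw [hΦ₃, ← hread h]
    exact (mem_462_iff_enum (ε h)).symm
  · exact hp₃
  · rw [hidx _ 1 (by rw [MulEquiv.apply_symm_apply]; decide)]; decide
  · exact hq₃
  · rw [hidx _ 7 (by rw [MulEquiv.apply_symm_apply]; decide)]; decide
  · intro h
    rw [hΦ₄, ← hread h]
    exact (mem_469_iff_enum (ε h)).symm
  · exact hp₄
  · rw [hidx _ 6 (by rw [MulEquiv.apply_symm_apply]; decide)]; decide
  · exact hq₄
  · rw [hidx _ 7 (by rw [MulEquiv.apply_symm_apply]; decide)]; decide
  · intro h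
    rw [hΦ₅, ← hread h]
    exact (mem_469_iff_enum (ε h)).symm
  · exact hp₅
  · rw [hidx _ 6 (by rw [MulEquiv.apply_symm_apply]; decide)]; decide
  · exact hq₅
  · rw [hidx _ 8 (by rw [MulEquiv.apply_symm_apply]; decide)]; decide

end Summit.HodgeConjecture.CorCM.DuodecicFaceTransport.Dicyclic

end
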